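import Mathlib
import HarnessLib
import HarnessLib.Audit

/-!
# ValiantsHypothesis / LacunarySymmetroid — crux `MatrixDescartes` (stmt-ValiantsHypothesis-18050, V1), LINE (A) «product_plus_one»:
# the WELL LEMMA for the modulator quartic `R` (pen val-idea-25 NOTE §54.17(g), §55.5; val-idea-crit-1 g10 #385a/#386/#390)

In the exact factorisation `D_f = (1+y_f)⁴ R(ρ_f)` of NOTE §54.12 the modulator of a row is `M = 1/R(ρ)` with the palindromic
quartic `R(ρ) = (1 + 2c₁ρ + ρ²)(1 + 2c₃ρ + ρ²)` (`Rquart c₁ c₃ ρ`, the pen g9 Sketch's text), `c_k = cos kπξ` for KC rows and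
`c_k = −cos kπξ` for W rows (the CHEBYSHEV CURVE `c₃ = T₃(c₁) = 4c₁³ − 3c₁`).  THE WELL LEMMA (NOTE §55.5 (A)(B)(C), proved there on
paper; here in the kernel, by a different elementary route):
* `wellLemmaB` = §55.5(B) VERBATIM (pen g9 Sketch `WellLemmaB`): general `c₁, c₃ ∈ [−1,1]`, `e = c₁ + c₃ < 0`, off the pole ⇒ there is
  `ρ_* ∈ (0,1)` with `R` strictly decreasing on `(0,ρ_*]` and strictly increasing on `[ρ_*,∞)` (EXACTLY ONE critical point).  The core
  `Rquart_loud` needs only `−2 < c₁ + c₃ < 0` (no bound on the `c_k`).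
* `wellLemmaA` = §55.5(A) VERBATIM (`WellLemmaA`): off the pole, `R` is strictly increasing on `[1,∞)`.
* `noWellLemma` = §55.5(C) VERBATIM (`NoWellLemma`): on the Chebyshev curve with `e ≥ 0` (KC `ξ ∈ (0,¼]`, W `ξ ∈ [¼,½)`), `R` is strictly
  increasing on `[0,∞)` — no well (false off the curve, pen §55.11 erratum; the core `Rquart'_pos_chebyshev` uses `c₃ = T₃(c₁)`).
PROOF ROUTE (not the NOTE's squared-critical-equation/Descartes route): `R′ = 2q`, `q(ρ) = 2ρ³ + 3eρ² + pρ + e`, `p = 2 + 4c₁c₃`, and the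
identity `ρq′ − q = 4ρ³ + 3eρ² − e = (ρ − σ/2)²(4ρ + σ) + σ(1 − σ²/4)` (`σ = −e ∈ (0,2)`) makes `q(ρ)/ρ` strictly increasing from `−∞` to
`+∞` on `(0,∞)`; `R′(1) = 8(1+c₁)(1+c₃)` places the critical point in `(0,1)`; on the curve with `e ≥ 0`, `p = (4a²−1)(4a²−2)` and
`q ≥ (1−2ε)·2ρ³ + 2ε·(2(ρ−½)²(ρ+1) + ρ/2) > 0`.

HONEST FRAMING: an exact, free-standing lemma about the modulator of LINE (A)'s A-function; it is NOT T1†/T′ or the A-LAW (located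
laws); no stub of LINE (A) is touched (A40 unchanged, sorries 4 → 4); `MatrixDescartes` OPEN; `VP ≠ VNP` is NOT proved and nothing
here bears on it.
-/

set_option linter.dupNamespace false

namespace Summit.ValiantsHypothesis.ValiantsHypothesis.Theorems.LacunarySymmetroidMatrixDescartes

namespace WellLemma

open Set Real

noncomputable section

/-- The palindromic quartic `R(ρ) = (1 + 2c₁ρ + ρ²)(1 + 2c₃ρ + ρ²)` whose reciprocal is the row modulator `M` (pen g9 Sketch text). -/
def Rquart (c₁ c₃ ρ : ℝ) : ℝ := (1 + 2 * c₁ * ρ + ρ ^ 2) * (1 + 2 * c₃ * ρ + ρ ^ 2)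

/-- Its derivative in `ρ`: `R′(ρ) = 2(2ρ³ + 3eρ² + pρ + e)`, `e = c₁ + c₃`, `p = 2 + 4c₁c₃`. -/
def Rquart' (c₁ c₃ ρ : ℝ) : ℝ := 2 * (2 * ρ ^ 3 + 3 * (c₁ + c₃) * ρ ^ 2 + (2 + 4 * c₁ * c₃) * ρ + (c₁ + c₃))

/-- The palindromic expansion of `R` (pen g9 Sketch `Rquart_expand`). -/
theorem Rquart_expand (c₁ c₃ ρ : ℝ) :
    Rquart c₁ c₃ ρ = 1 + 2 * (c₁ + c₃) * ρ + (2 + 4 * c₁ * c₃) * ρ ^ 2 + 2 * (c₁ + c₃) * ρ ^ 3 + ρ ^ 4 := by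
  unfold Rquart; ring

/-- `R′ = Rquart'`. -/
theorem hasDerivAt_Rquart (c₁ c₃ ρ : ℝ) : HasDerivAt (Rquart c₁ c₃) (Rquart' c₁ c₃ ρ) ρ := by
  have h1 : HasDerivAt (fun ρ : ℝ => 1 + 2 * c₁ * ρ + ρ ^ 2) (2 * c₁ + 2 * ρ) ρ := by
    have := (((hasDerivAt_id ρ).const_mul (2 * c₁)).const_add 1).add (hasDerivAt_pow 2 ρ)
    refine this.congr_deriv ?_
    simp
  have h2 : HasDerivAt (fun ρ : ℝ => 1 + 2 * c₃ * ρ + ρ ^ 2) (2 * c₃ + 2 * ρ) ρ := by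
    have := (((hasDerivAt_id ρ).const_mul (2 * c₃)).const_add 1).add (hasDerivAt_pow 2 ρ)
    refine this.congr_deriv ?_
    simp
  have e : Rquart c₁ c₃ = fun ρ => (1 + 2 * c₁ * ρ + ρ ^ 2) * (1 + 2 * c₃ * ρ + ρ ^ 2) := by funext ρ; rfl
  rw [e]
  refine (h1.fun_mul h2).congr_deriv ?_
  rw [Rquart']; ring

/-- `R` is continuous. -/
theorem continuous_Rquart (c₁ c₃ : ℝ) : Continuous (Rquart c₁ c₃) :=
  continuous_iff_continuousAt.2 fun ρ => (hasDerivAt_Rquart c₁ c₃ ρ).continuousAt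

/-- `R′(1) = 8(1 + c₁)(1 + c₃)` (the pole `c₁ = c₃ = −1`-type factor; `≥ 0` whenever `c_k ≥ −1`). -/
theorem Rquart'_one (c₁ c₃ : ℝ) : Rquart' c₁ c₃ 1 = 8 * (1 + c₁) * (1 + c₃) := by
  rw [Rquart']; ring

/-- Off the pole values (`|c_k| < 1`) the quartic is positive on all of `ℝ`. -/
theorem Rquart_pos {c₁ c₃ : ℝ} (h1 : |c₁| < 1) (h3 : |c₃| < 1) (ρ : ℝ) : 0 < Rquart c₁ c₃ ρ := by
  rw [Rquart]
  have h1' := abs_lt.1 h1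
  have h3' := abs_lt.1 h3
  exact mul_pos (by nlinarith [sq_nonneg (ρ + c₁)]) (by nlinarith [sq_nonneg (ρ + c₃)])

/-- KC rows: `R_ξ = Rquart (cos πξ) (cos 3πξ)` lies on the Chebyshev curve `c₃ = 4c₁³ − 3c₁`. -/
theorem chebyshev_KC (ξ : ℝ) : cos (3 * π * ξ) = 4 * cos (π * ξ) ^ 3 - 3 * cos (π * ξ) := by
  rw [mul_assoc, cos_three_mul]

/-- W rows: `R_ξ = Rquart (−cos πξ) (−cos 3πξ)` lies on the same curve (`T₃` is odd). -/
theorem chebyshev_W (ξ : ℝ) : -cos (3 * π * ξ) = 4 * (-cos (π * ξ)) ^ 3 - 3 * (-cos (π * ξ)) := by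
  rw [mul_assoc, cos_three_mul]; ring

/-- The cubic estimate behind the loud case: `4ρ³ − 3σρ² + σ > 0` for `0 < σ < 2`, `ρ ≥ 0`
(`= (ρ − σ/2)²(4ρ + σ) + σ(1 − σ²/4)`). -/
theorem cubic_aux {σ ρ : ℝ} (hσ : 0 < σ) (hσ2 : σ < 2) (hρ : 0 ≤ ρ) : 0 < 4 * ρ ^ 3 - 3 * σ * ρ ^ 2 + σ := by
  have e : 4 * ρ ^ 3 - 3 * σ * ρ ^ 2 + σ = (ρ - σ / 2) ^ 2 * (4 * ρ + σ) + σ * (1 - σ ^ 2 / 4) := by ring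
  rw [e]
  have h1 : 0 < 1 - σ ^ 2 / 4 := by nlinarith
  have h2 : 0 ≤ (ρ - σ / 2) ^ 2 * (4 * ρ + σ) := mul_nonneg (sq_nonneg _) (by linarith)
  nlinarith [mul_pos hσ h1]

/-! ## Loud types: exactly one critical point -/

/-- **WELL LEMMA, loud core** (general pairs, only `−2 < e = c₁ + c₃ < 0` assumed): `R` has EXACTLY ONE critical point `ρ₀`
on `(0,∞)`, with `R′ < 0` on `(0,ρ₀)` and `R′ > 0` on `(ρ₀,∞)`. -/
theorem Rquart_loud {c₁ c₃ : ℝ} (he2 : -2 < c₁ + c₃) (he : c₁ + c₃ < 0) :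
    ∃ ρ₀ : ℝ, 0 < ρ₀ ∧ Rquart' c₁ c₃ ρ₀ = 0 ∧ (∀ ρ, 0 < ρ → ρ < ρ₀ → Rquart' c₁ c₃ ρ < 0) ∧
      (∀ ρ, ρ₀ < ρ → 0 < Rquart' c₁ c₃ ρ) := by
  set s : ℝ := c₁ + c₃ with hs_def
  set p : ℝ := 2 + 4 * c₁ * c₃ with hp_def
  -- g(ρ) = q(ρ)/ρ, strictly increasing on (0,∞)
  set g : ℝ → ℝ := fun ρ => 2 * ρ ^ 2 + 3 * s * ρ + p + s / ρ with hg
  have hR' : ∀ ρ, ρ ≠ 0 → Rquart' c₁ c₃ ρ = 2 * ρ * g ρ := by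
    intro ρ hρ
    simp only [Rquart', hg, ← hs_def, ← hp_def]
    field_simp
  have hderiv : ∀ ρ, 0 < ρ → HasDerivAt g ((4 * ρ ^ 3 + 3 * s * ρ ^ 2 - s) / ρ ^ 2) ρ := by
    intro ρ hρ
    have h1 : HasDerivAt (fun ρ : ℝ => 2 * ρ ^ 2 + 3 * s * ρ + p) (2 * (2 * ρ) + 3 * s) ρ := by
      exact ((((hasDerivAt_pow 2 ρ).const_mul 2).add ((hasDerivAt_id ρ).const_mul (3 * s))).add_const p).congr_deriv
        (by simp)
    have h2 : HasDerivAt (fun ρ : ℝ => s / ρ) (-(s / ρ ^ 2)) ρ := by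
      have := (hasDerivAt_inv hρ.ne').const_mul s
      refine (this.congr_deriv ?_).congr_of_eventuallyEq (Filter.Eventually.of_forall fun x => by
        show s / x = s * x⁻¹; rw [div_eq_mul_inv])
      ring
    refine (h1.add h2).congr_deriv ?_
    field_simp
    ring
  have hcont : ContinuousOn g (Ioi 0) := fun ρ hρ => (hderiv ρ hρ).continuousAt.continuousWithinAt
  have hmono : StrictMonoOn g (Ioi 0) := by
    refine strictMonoOn_of_deriv_pos (convex_Ioi 0) hcont fun ρ hρ => ?_
    rw [interior_Ioi] at hρ
    rw [(hderiv ρ hρ).deriv]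
    have := cubic_aux (σ := -s) (by linarith) (by linarith) (le_of_lt hρ)
    exact div_pos (by linarith) (pow_pos hρ 2)
  -- a negative and a positive value of g
  set ρ₁ : ℝ := min (1 / 2) ((-s) / (|p| + 2)) with hρ₁
  set ρ₂ : ℝ := 4 * (-s) + |p| + 1 with hρ₂
  have hσ : 0 < -s := by linarith
  have hρ₁pos : 0 < ρ₁ := lt_min (by norm_num) (div_pos hσ (by positivity))
  have hρ₁le : ρ₁ ≤ 1 / 2 := min_le_left _ _
  have hρ₁le' : ρ₁ ≤ (-s) / (|p| + 2) := min_le_right _ _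
  have hg₁ : g ρ₁ < 0 := by
    have h1 : |p| + 2 ≤ (-s) / ρ₁ := by
      rw [le_div_iff₀ hρ₁pos]
      have := (le_div_iff₀ (by positivity : (0 : ℝ) < |p| + 2)).1 hρ₁le'
      linarith
    have h2 : 3 * s * ρ₁ ≤ 0 := by nlinarith
    have h3 : 2 * ρ₁ ^ 2 ≤ 1 / 2 := by nlinarith
    have h4 : p ≤ |p| := le_abs_self p
    have : g ρ₁ = 2 * ρ₁ ^ 2 + 3 * s * ρ₁ + p + s / ρ₁ := rfl
    rw [this]
    have h5 : s / ρ₁ = -((-s) / ρ₁) := by ring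
    linarith
  have hρ₂ge : 1 ≤ ρ₂ := by have := abs_nonneg p; rw [hρ₂]; linarith
  have hg₂ : 0 < g ρ₂ := by
    have hρ₂pos : 0 < ρ₂ := by linarith
    have h1 : s ≤ s / ρ₂ := by
      rw [le_div_iff₀ hρ₂pos]; nlinarith
    have h4 : -|p| ≤ p := neg_abs_le p
    have : g ρ₂ = 2 * ρ₂ ^ 2 + 3 * s * ρ₂ + p + s / ρ₂ := rfl
    rw [this]
    nlinarith [abs_nonneg p]
  have h12 : ρ₁ < ρ₂ := by linarith
  obtain ⟨ρ₀, hρ₀, hg₀⟩ : ∃ ρ₀ ∈ Ioo ρ₁ ρ₂, g ρ₀ = 0 := by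
    have hc : ContinuousOn g (Icc ρ₁ ρ₂) := hcont.mono fun x hx => hρ₁pos.trans_le hx.1
    exact intermediate_value_Ioo h12.le hc ⟨hg₁, hg₂⟩
  have hρ₀pos : 0 < ρ₀ := hρ₁pos.trans hρ₀.1
  refine ⟨ρ₀, hρ₀pos, ?_, fun ρ hρ hlt => ?_, fun ρ hlt => ?_⟩
  · rw [hR' ρ₀ hρ₀pos.ne', hg₀, mul_zero]
  · rw [hR' ρ hρ.ne']
    have : g ρ < g ρ₀ := hmono hρ hρ₀pos hlt
    rw [hg₀] at this
    nlinarith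
  · have hρ : 0 < ρ := hρ₀pos.trans hlt
    rw [hR' ρ hρ.ne']
    have : g ρ₀ < g ρ := hmono hρ₀pos hρ hlt
    rw [hg₀] at this
    positivity

/-- **§55.5(B) — the pen g9 Sketch's `WellLemmaB`, VERBATIM**: for `c₁, c₃ ∈ [−1,1]` with `e = c₁ + c₃ < 0` and off the pole,
`R` has exactly one critical point `ρ_* ∈ (0,1)`: strictly decreasing on `(0,ρ_*]`, strictly increasing on `[ρ_*,∞)`. -/
theorem wellLemmaB : ∀ c₁ c₃ : ℝ, |c₁| ≤ 1 → |c₃| ≤ 1 → c₁ + c₃ < 0 → (1 + c₁) * (1 + c₃) ≠ 0 →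
    ∃ ρs : ℝ, 0 < ρs ∧ ρs < 1 ∧
      StrictAntiOn (Rquart c₁ c₃) (Set.Ioc 0 ρs) ∧ StrictMonoOn (Rquart c₁ c₃) (Set.Ici ρs) := by
  intro c₁ c₃ h1 h3 he hpole
  have h1' := abs_le.1 h1
  have h3' := abs_le.1 h3
  have he2 : -2 < c₁ + c₃ := by
    rcases lt_or_eq_of_le (show -1 ≤ c₁ from h1'.1) with hlt | heq
    · linarith [h3'.1]
    · exfalso; apply hpole; rw [← heq]; ring
  obtain ⟨ρ₀, hρ₀, hzero, hneg, hpos⟩ := Rquart_loud he2 he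
  have hR1 : 0 < Rquart' c₁ c₃ 1 := by
    rw [Rquart'_one]
    have ha : 0 ≤ 1 + c₁ := by linarith [h1'.1]
    have hb : 0 ≤ 1 + c₃ := by linarith [h3'.1]
    rcases (mul_nonneg ha hb).lt_or_eq with h | h
    · linarith
    · exact absurd h.symm hpole
  have hlt1 : ρ₀ < 1 := by
    by_contra h
    push Not at h
    rcases h.lt_or_eq with h | h
    · exact absurd hR1 (not_lt.2 (hneg 1 one_pos h).le)
    · rw [← h] at hzero; rw [hzero] at hR1; exact lt_irrefl _ hR1
  refine ⟨ρ₀, hρ₀, hlt1, ?_, ?_⟩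
  · refine strictAntiOn_of_deriv_neg (convex_Ioc 0 ρ₀) (continuous_Rquart c₁ c₃).continuousOn fun ρ hρ => ?_
    rw [interior_Ioc] at hρ
    rw [(hasDerivAt_Rquart c₁ c₃ ρ).deriv]
    exact hneg ρ hρ.1 hρ.2
  · refine strictMonoOn_of_deriv_pos (convex_Ici ρ₀) (continuous_Rquart c₁ c₃).continuousOn fun ρ hρ => ?_
    rw [interior_Ici] at hρ
    rw [(hasDerivAt_Rquart c₁ c₃ ρ).deriv]
    exact hpos ρ hρ

/-- **§55.5(A) — the pen g9 Sketch's `WellLemmaA`, VERBATIM**: off the pole, `R` is strictly increasing on `[1,∞)` (all types, all `ξ`). -/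
theorem wellLemmaA : ∀ c₁ c₃ : ℝ, |c₁| ≤ 1 → |c₃| ≤ 1 → (1 + c₁) * (1 + c₃) ≠ 0 →
    StrictMonoOn (Rquart c₁ c₃) (Set.Ici 1) := by
  intro c₁ c₃ h1 h3 hpole
  have h1' := abs_le.1 h1
  have h3' := abs_le.1 h3
  refine strictMonoOn_of_deriv_pos (convex_Ici 1) (continuous_Rquart c₁ c₃).continuousOn fun ρ hρ => ?_
  rw [interior_Ici] at hρ
  have hρ1 : (1 : ℝ) < ρ := hρ
  rw [(hasDerivAt_Rquart c₁ c₃ ρ).deriv]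
  rcases lt_or_ge (c₁ + c₃) 0 with he | he
  · -- loud: the unique critical point lies in (0,1)
    obtain ⟨ρs, _, hlt1, _, _⟩ := wellLemmaB c₁ c₃ h1 h3 he hpole
    have he2 : -2 < c₁ + c₃ := by
      rcases lt_or_eq_of_le (show -1 ≤ c₁ from h1'.1) with hlt | heq
      · linarith [h3'.1]
      · exfalso; apply hpole; rw [← heq]; ring
    obtain ⟨ρ₀, hρ₀, hzero, hneg, hpos⟩ := Rquart_loud he2 he
    -- ρ₀ < 1 (same argument as in wellLemmaB)
    have hR1 : 0 < Rquart' c₁ c₃ 1 := by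
      rw [Rquart'_one]
      rcases (mul_nonneg (by linarith [h1'.1] : (0:ℝ) ≤ 1 + c₁) (by linarith [h3'.1] : (0:ℝ) ≤ 1 + c₃)).lt_or_eq with h | h
      · linarith
      · exact absurd h.symm hpole
    have hρ₀1 : ρ₀ < 1 := by
      by_contra h
      push Not at h
      rcases h.lt_or_eq with h | h
      · exact absurd hR1 (not_lt.2 (hneg 1 one_pos h).le)
      · rw [← h] at hzero; rw [hzero] at hR1; exact lt_irrefl _ hR1
    exact hpos ρ (hρ₀1.trans hρ1)
  · -- e ≥ 0: q(ρ) ≥ 2ρ(ρ² − 1) > 0 for ρ > 1 since p ≥ −2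
    rw [Rquart']
    have hp : -2 ≤ 2 + 4 * c₁ * c₃ := by nlinarith
    nlinarith [mul_nonneg he (sq_nonneg ρ), mul_pos (by linarith : (0:ℝ) < ρ) (by nlinarith : (0:ℝ) < ρ ^ 2 - 1)]

/-! ## Tame types on the Chebyshev curve: no well -/

/-- **WELL LEMMA, tame core on the Chebyshev curve** (`c₃ = 4a³ − 3a`, `e = 4a³ − 2a ≥ 0`; any real `a`): `R′ > 0` on `(0,∞)`. -/
theorem Rquart'_pos_chebyshev {a : ℝ} (hs : 0 ≤ 4 * a ^ 3 - 2 * a) :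
    ∀ ρ, 0 < ρ → 0 < Rquart' a (4 * a ^ 3 - 3 * a) ρ := by
  intro ρ hρ
  rw [Rquart']
  have he : a + (4 * a ^ 3 - 3 * a) = 4 * a ^ 3 - 2 * a := by ring
  have hp : 2 + 4 * a * (4 * a ^ 3 - 3 * a) = (4 * a ^ 2 - 1) * (4 * a ^ 2 - 2) := by ring
  rw [he, hp]
  by_cases hp0 : 0 ≤ (4 * a ^ 2 - 1) * (4 * a ^ 2 - 2)
  · have h1 : 0 ≤ 3 * (4 * a ^ 3 - 2 * a) * ρ ^ 2 := by positivity
    have h2 : 0 ≤ (4 * a ^ 2 - 1) * (4 * a ^ 2 - 2) * ρ := by positivity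
    have h3 : 0 < 2 * ρ ^ 3 := by positivity
    linarith
  · push Not at hp0
    have hx1 : 1 < 4 * a ^ 2 := by
      by_contra h; push Not at h
      have : 0 ≤ (4 * a ^ 2 - 1) * (4 * a ^ 2 - 2) := mul_nonneg_of_nonpos_of_nonpos (by linarith) (by linarith)
      linarith
    have hx2 : 4 * a ^ 2 < 2 := by
      by_contra h; push Not at h
      have : 0 ≤ (4 * a ^ 2 - 1) * (4 * a ^ 2 - 2) := mul_nonneg (by linarith) (by linarith)
      linarith
    have hale : a ≤ 0 := by
      by_contra h; push Not at h
      have e : 4 * a ^ 3 - 2 * a = 2 * a * (2 * a ^ 2 - 1) := by ring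
      have : 4 * a ^ 3 - 2 * a < 0 := by rw [e]; exact mul_neg_of_pos_of_neg (by linarith) (by linarith)
      linarith
    set ε : ℝ := 1 - 2 * a ^ 2 with hε
    have hε0 : 0 < ε := by rw [hε]; linarith
    have hε1 : ε ≤ 1 / 2 := by rw [hε]; linarith
    have hsε : ε ≤ 4 * a ^ 3 - 2 * a := by
      have e : 4 * a ^ 3 - 2 * a = 2 * (-a) * ε := by rw [hε]; ring
      have ha2 : 1 / 2 ≤ -a := by nlinarith
      rw [e]; nlinarith
    have hpε : -2 * ε ≤ (4 * a ^ 2 - 1) * (4 * a ^ 2 - 2) := by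
      have e : (4 * a ^ 2 - 1) * (4 * a ^ 2 - 2) = -2 * ε * (4 * a ^ 2 - 1) := by rw [hε]; ring
      rw [e]; nlinarith
    have hkey : 0 < 2 * ρ ^ 3 - 2 * ε * ρ + ε := by
      have e : 2 * ρ ^ 3 - 2 * ε * ρ + ε = (1 - 2 * ε) * (2 * ρ ^ 3) + 2 * ε * (2 * (ρ - 1 / 2) ^ 2 * (ρ + 1) + ρ / 2) := by
        ring
      rw [e]
      have h1 : 0 ≤ (1 - 2 * ε) * (2 * ρ ^ 3) := mul_nonneg (by linarith) (by positivity)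
      have h2 : 0 < 2 * (ρ - 1 / 2) ^ 2 * (ρ + 1) + ρ / 2 := by positivity
      nlinarith [mul_pos hε0 h2]
    have h1 : 0 ≤ 3 * (4 * a ^ 3 - 2 * a) * ρ ^ 2 := by positivity
    nlinarith [mul_le_mul_of_nonneg_right hpε hρ.le]

/-- **§55.5(C) — the pen g9 Sketch's `NoWellLemma`, VERBATIM**: on the Chebyshev curve `c₁ = s·cos(πξ)`, `c₃ = s·cos(3πξ)`
(`s = 1`: KC, `s = −1`: W) with `e ≥ 0`, `R` is strictly increasing on `[0,∞)`: no well. -/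
theorem noWellLemma : ∀ (ξ s : ℝ), 0 < ξ → ξ < 1 / 2 → (s = 1 ∨ s = -1) →
    0 ≤ s * Real.cos (Real.pi * ξ) + s * Real.cos (3 * Real.pi * ξ) →
      StrictMonoOn (Rquart (s * Real.cos (Real.pi * ξ)) (s * Real.cos (3 * Real.pi * ξ))) (Set.Ici 0) := by
  intro ξ s _ _ hs he
  -- on the curve: s cos 3πξ = 4(s cos πξ)³ − 3(s cos πξ) since s³ = s
  have hcurve : s * cos (3 * π * ξ) = 4 * (s * cos (π * ξ)) ^ 3 - 3 * (s * cos (π * ξ)) := by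
    rcases hs with rfl | rfl
    · rw [one_mul, one_mul, chebyshev_KC]
    · rw [neg_one_mul, neg_one_mul, chebyshev_W]
  have he' : 0 ≤ 4 * (s * cos (π * ξ)) ^ 3 - 2 * (s * cos (π * ξ)) := by
    have : s * cos (π * ξ) + s * cos (3 * π * ξ) = 4 * (s * cos (π * ξ)) ^ 3 - 2 * (s * cos (π * ξ)) := by
      rw [hcurve]; ring
    rwa [this] at he
  rw [hcurve]
  refine strictMonoOn_of_deriv_pos (convex_Ici 0) (continuous_Rquart _ _).continuousOn fun ρ hρ => ?_
  rw [interior_Ici] at hρ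
  rw [(hasDerivAt_Rquart _ _ ρ).deriv]
  exact Rquart'_pos_chebyshev he' ρ hρ

/-! ## The `ξ`-forms of the loud case -/

/-- KC rows with `ξ ∈ (¼, ½)`: `e = cos πξ + cos 3πξ = 2cos(πξ)cos(2πξ) < 0` — a LOUD type: if moreover `ξ ≠ ⅓` (off the pole
`cos 3πξ = −1`) the well bottom `ρ_* ∈ (0,1)` exists as in `wellLemmaB`. -/
theorem wellLemmaB_KC {ξ : ℝ} (h1 : 1 / 4 < ξ) (h2 : ξ < 1 / 2) (hpole : cos (3 * π * ξ) ≠ -1) :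
    ∃ ρs : ℝ, 0 < ρs ∧ ρs < 1 ∧ StrictAntiOn (Rquart (cos (π * ξ)) (cos (3 * π * ξ))) (Set.Ioc 0 ρs) ∧
      StrictMonoOn (Rquart (cos (π * ξ)) (cos (3 * π * ξ))) (Set.Ici ρs) := by
  have hc : 0 < cos (π * ξ) := cos_pos_of_mem_Ioo ⟨by nlinarith [pi_pos], by nlinarith [pi_pos]⟩
  have hc2 : cos (2 * (π * ξ)) < 0 :=
    cos_neg_of_pi_div_two_lt_of_lt (by nlinarith [pi_pos]) (by nlinarith [pi_pos])
  have he : cos (π * ξ) + cos (3 * π * ξ) < 0 := by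
    have e : cos (π * ξ) + cos (3 * π * ξ) = 2 * cos (π * ξ) * cos (2 * (π * ξ)) := by
      rw [chebyshev_KC, cos_two_mul]; ring
    rw [e]; exact mul_neg_of_pos_of_neg (by linarith) hc2
  refine wellLemmaB _ _ (abs_cos_le_one _) (abs_cos_le_one _) he ?_
  have : 1 + cos (3 * π * ξ) ≠ 0 := fun h => hpole (by linarith)
  exact mul_ne_zero (by linarith) this

/-- W rows with `ξ ∈ (0, ¼)`: `e = −cos πξ − cos 3πξ = −2cos(πξ)cos(2πξ) < 0` — a LOUD type (no pole on this range): the well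
bottom `ρ_* ∈ (0,1)` exists as in `wellLemmaB`. -/
theorem wellLemmaB_W {ξ : ℝ} (h1 : 0 < ξ) (h2 : ξ < 1 / 4) :
    ∃ ρs : ℝ, 0 < ρs ∧ ρs < 1 ∧ StrictAntiOn (Rquart (-cos (π * ξ)) (-cos (3 * π * ξ))) (Set.Ioc 0 ρs) ∧
      StrictMonoOn (Rquart (-cos (π * ξ)) (-cos (3 * π * ξ))) (Set.Ici ρs) := by
  have hc : 0 < cos (π * ξ) := cos_pos_of_mem_Ioo ⟨by nlinarith [pi_pos], by nlinarith [pi_pos]⟩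
  have hc1 : cos (π * ξ) < 1 := by
    have := cos_lt_cos_of_nonneg_of_le_pi_div_two le_rfl (by nlinarith [pi_pos]) (by nlinarith [pi_pos] : (0:ℝ) < π * ξ)
    rwa [cos_zero] at this
  have hc2 : 0 < cos (2 * (π * ξ)) := cos_pos_of_mem_Ioo ⟨by nlinarith [pi_pos], by nlinarith [pi_pos]⟩
  have he : -cos (π * ξ) + -cos (3 * π * ξ) < 0 := by
    have e : -cos (π * ξ) + -cos (3 * π * ξ) = -(2 * cos (π * ξ) * cos (2 * (π * ξ))) := by
      rw [chebyshev_KC, cos_two_mul]; ring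
    rw [e]; exact neg_neg_of_pos (mul_pos (by linarith) hc2)
  refine wellLemmaB _ _ (by rw [abs_neg]; exact abs_cos_le_one _) (by rw [abs_neg]; exact abs_cos_le_one _) he ?_
  have h3 : -cos (3 * π * ξ) ≠ -1 := by
    intro h
    -- cos 3πξ = 1 with 3πξ ∈ (0, 3π/4): impossible
    have h' : cos (3 * π * ξ) = 1 := by linarith
    have h0 : 3 * π * ξ = 0 :=
      (cos_eq_one_iff_of_lt_of_lt (by nlinarith [pi_pos]) (by nlinarith [pi_pos])).1 h'
    nlinarith [pi_pos]
  exact mul_ne_zero (by linarith) (fun h => h3 (by linarith))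

end

end WellLemma

end Summit.ValiantsHypothesis.ValiantsHypothesis.Theorems.LacunarySymmetroidMatrixDescartes
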